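import Summits.ResolutionOfSingularities.ResolutionOfSingularities.Theorems.RadicialJungCleanModelsSufficeRoundOverRadicand
import Summits.ResolutionOfSingularities.ResolutionOfSingularities.Theorems.RadicialJungCleanModelsSufficeRoundOverMeasures
import Summits.ResolutionOfSingularities.ResolutionOfSingularities.Theorems.PAlterationPicoverTowerTransport
import Literature.AlgebraicGeometry.Resolution.BlowupSNCChartDataRsop
import Literature.AlgebraicGeometry.Resolution.BlowupsExistence
import Literature.AlgebraicGeometry.Resolution.BlowupsIntegral
import Literature.AlgebraicGeometry.Resolution.BlowupsProperProofs
import Literature.AlgebraicGeometry.Resolution.AlterationsResolution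
import Literature.AlgebraicGeometry.Resolution.ComponentGluing
import Literature.AlgebraicGeometry.Motives.CartierDivisor
import Mathlib.AlgebraicGeometry.FunctionField

/-!
# Route `RadicialJung`, crux `CleanModelsSuffice`, line `Sketch`: one round over the centre (`stub_gameRoundOver`)

The registered stub `stub_gameRoundOver` of the skeleton of
`Summit.ResolutionOfSingularities.ResolutionOfSingularities.Theses.RadicialJung.CleanModelsSuffice`
(stmt-ResolutionOfSingularities-15883): ONE ROUND of the exceptionalisation game AT A POINT OVER THE CENTRE. Given a
game state `S` on the model `π : V → V₀`, an admissible centre `Z` (at each of its points the coordinate subspace of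
at least two charged coordinates `I v`) and its blow-up `φ : V' → V`, at every `x ∈ V'` over `v ∈ Z` there are
pointwise data `P` (a labelled regular system of parameters of `𝒪_{V',x}`, exponents `0` or prime to `p`, a unit, a
generator `y'` of `L` with `y'^p = g'` and `(φ ≫ π)^* g' = w' ∏ v'^{a'}`, the REG clause) for the new boundary
`E.map (strictTransformIdeal φ C) ++ [C·𝒪_{V'}]`, such that `mOld` does not go up, drops when the centre is the set
of all old charged coordinates (phase 1), and over a phase-2 centre the charges and resonances transform as in the
round contract.

Proof: the chart of the blow-up at `x` adapted to the state's labelled coordinates (`exists_chartData_of_rsop'`),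
the labels of the new boundary (`roundOver_exists_lab`), the radicand upstairs (`roundOver_map_radicand`,
`roundOver_label_prod`; when `p ∣ Σ_centre a` the factor `x_i^{Σ a}` is a `p`-th power and is moved into the
generator: `y' = y / κ`, `g' = g / κ^p`), the REG clause (`roundOver_reg`) and the measures (`roundOver_measures`).
-/

noncomputable section

set_option linter.dupNamespace false -- mandated namespace of this single-conjunct summit

open CategoryTheory AlgebraicGeometry TopologicalSpace IsLocalRing
open Literature.AlgebraicGeometry.Resolution Literature.AlgebraicGeometry.Motives

namespace Summit.ResolutionOfSingularities.ResolutionOfSingularities.Theorems.RadicialJung.CleanModelsSuffice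

section Main

local notation3 "φch[" Dc "]" => reesChartBase (ChartData.x Dc (ChartData.i Dc))
  (Ideal.mem_span_range_self (f := ChartData.x Dc) (x := ChartData.i Dc))


set_option maxHeartbeats 1600000 in
/-- **One round of the game at a point over the centre** (registered stub `stub_gameRoundOver` of the line `Sketch`):
see the module docstring. [folklore] -/
theorem stub_gameRoundOver (p : ℕ) (hp : p.Prime) (k : Type) [Field k] [CharP k p]
    (V₀ : Scheme.{0}) [IsIntegral V₀] (f₀ : V₀ ⟶ Spec (.of k)) (L : Type) [Field L]
    [Algebra V₀.functionField L] [LocallyOfFiniteType f₀] [QuasiCompact f₀]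
    (hdeg : Module.finrank V₀.functionField L = p)
    (V : Scheme.{0}) [IsIntegral V] (π : V ⟶ V₀) [IsDominant π] [IsProper π] (hbir : IsBirational π)
    (S : GameState p V₀ L V π) (Z : Set V) (hZ : IsClosed Z)
    (I : ∀ v : V, v ∈ Z → Finset (Fin (S.d v))) (hadm : S.Admissible Z hZ I)
    (V' : Scheme.{0}) [IsIntegral V'] (φ : V' ⟶ V) [IsDominant (φ ≫ π)]
    (hφ : IsBlowup φ (Scheme.IdealSheafData.vanishingIdeal ⟨Z, hZ⟩)) (x : V') (hx : φ x ∈ Z) :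
    ∃ P : GameState.PointData p V₀ L V' (φ ≫ π)
        (S.E.map (strictTransformIdeal φ (Scheme.IdealSheafData.vanishingIdeal ⟨Z, hZ⟩)) ++
          [(Scheme.IdealSheafData.vanishingIdeal ⟨Z, hZ⟩).comap φ]) x,
      P.mOld ≤ S.mOld (φ x) ∧
      (I (φ x) hx = S.oldCh (φ x) → P.mOld < S.mOld (φ x)) ∧
      (∀ D₀ : {D : V.IdealSheafData // D ∈ S.E ∧ φ x ∈ D.support},
        S.mOld (φ x) = 1 → S.chargedAt D₀.1 (φ x) →
        I (φ x) hx = S.oldCh (φ x) ∪ {S.lab (φ x) D₀} → P.mOld = 1 →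
          ¬ P.chargedAt (strictTransformIdeal φ (Scheme.IdealSheafData.vanishingIdeal ⟨Z, hZ⟩) D₀.1) ∧
          (∀ D ∈ S.E, D ≠ D₀.1 →
            (P.chargedAt (strictTransformIdeal φ (Scheme.IdealSheafData.vanishingIdeal ⟨Z, hZ⟩) D) ↔
              S.chargedAt D (φ x)) ∧
            (S.chargedAt D (φ x) →
              P.Nval (strictTransformIdeal φ (Scheme.IdealSheafData.vanishingIdeal ⟨Z, hZ⟩) D) =
                S.Nval (φ x) D)) ∧
          (P.chargedAt ((Scheme.IdealSheafData.vanishingIdeal ⟨Z, hZ⟩).comap φ) →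
            P.Nval ((Scheme.IdealSheafData.vanishingIdeal ⟨Z, hZ⟩).comap φ) + 1 = S.Nval (φ x) D₀.1)) := by
  classical
  have _ := hdeg
  set C := Scheme.IdealSheafData.vanishingIdeal (⟨Z, hZ⟩ : Closeds V) with hC
  set v := φ x with hv
  haveI : IsLocallyNoetherian V := LocallyOfFiniteType.isLocallyNoetherian (π ≫ f₀)
  haveI : IsProper φ := hφ.isProper
  haveI : IsLocallyNoetherian V' := LocallyOfFiniteType.isLocallyNoetherian φ
  haveI hregv : IsRegularLocalRing (V.presheaf.stalk v) := S.isRegular v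
  have hxC : φ x ∈ C.support := by
    rw [← SetLike.mem_coe, hC, Scheme.IdealSheafData.coe_support_vanishingIdeal]; exact hx
  -- the chart from the state's own labelled regular system at `v`
  obtain ⟨Dc, σ, σ', hσ, hσ', hrσ, hrσ', hassx, hassw⟩ :=
    exists_chartData_of_rsop' hφ x hxC hregv (S.spanFinrank_eq v) (S.u v) (S.span_u v) (I v hx)
      (hadm.stalkIdeal_eq v hx)
  obtain ⟨hregx, d', v', hsf', hspan', lab', hlab'inj, hv0, hvw, hve⟩ := Dc.exists_rsop hxC
  haveI : IsDomain (V'.presheaf.stalk x) := by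
    haveI := hregx; exact Literature.AlgebraicGeometry.Resolution.isDomain_of_isRegularLocalRing _
  letI := Dc.algB
  haveI := Dc.isLocalization_B
  -- the two enumerations cover the coordinates disjointly
  have hrσσ' : ∀ t, t ∈ Set.range σ ∨ t ∈ Set.range σ' := fun t => by
    by_cases ht : t ∈ ((I v hx : Finset _) : Set (Fin (S.d v)))
    · left; rwa [hrσ]
    · right; rw [hrσ']; exact ht
  have hdisj : ∀ l m, σ l ≠ σ' m := fun l m h => by
    have h1 : σ l ∈ Set.range σ := ⟨l, rfl⟩
    have h2 : σ' m ∈ Set.range σ' := ⟨m, rfl⟩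
    rw [hrσ] at h1; rw [hrσ', h.symm] at h2
    exact h2 h1
  -- labels of the new boundary, images of the coordinates
  obtain ⟨lab, hlabinj, hlabst, hlabE, hlabW, hlabX, hsuppW, hsuppX⟩ :=
    roundOver_exists_lab S hxC Dc σ σ' hrσσ' hassx hassw v' hregx hsf' hspan' lab' hlab'inj hv0 hvw hve
  obtain ⟨hcx', hcw'⟩ := roundOver_map_coord Dc (S.u v) σ σ' hassx hassw
  choose cx hcx using hcx'
  choose cw hcw using hcw'
  -- the exponents upstairs
  let aOf : Option (Fin Dc.a ⊕ Dc.GoodGen) → ℕ := fun o =>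
    o.elim (if p ∣ ∑ l, S.a v (σ l) then 0 else ∑ l, S.a v (σ l))
      (Sum.elim (fun m => S.a v (σ' m)) (fun g => S.a v (σ g.1)))
  let a' : Fin d' → ℕ := Function.extend lab' aOf 0
  have ha'lab : ∀ o, a' (lab' o) = aOf o := fun o => hlab'inj.extend_apply _ _ _
  have ha'off : ∀ i', (¬ ∃ o, lab' o = i') → a' i' = 0 := fun i' h => by
    change Function.extend lab' aOf 0 i' = 0
    rw [Function.extend_apply' _ _ _ h]; rfl
  -- the new unit and the two product identities
  obtain ⟨hw', hmap⟩ := roundOver_map_radicand Dc (S.u v) (S.a v) (S.w v) (S.isUnit_w v) σ σ' hσ hσ' hrσσ'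
    hdisj cx cw hcx hcw
  set w' := (φ.stalkMap x).hom (S.w v) *
    ((∏ l, (φ.stalkMap x).hom ↑(cx l) ^ S.a v (σ l)) * ∏ m, (φ.stalkMap x).hom ↑(cw m) ^ S.a v (σ' m)) *
    ∏ l, (if l ≠ Dc.i ∧ Dc.gen l ∈ Dc.Q then 1 else Dc.toStalk (Dc.gen l) ^ S.a v (σ l)) with hw'def
  have hlabprod := roundOver_label_prod Dc (S.a v) σ σ' v' lab' hlab'inj hv0 hvw hve aOf (fun _ => rfl) (fun _ => rfl)
  -- the function fields: `K(V₀) ≅ K(V')` along the birational `φ ≫ π`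
  have hCne : C ≠ ⊥ := by
    intro hbot
    have hst : stalkIdeal C v = ⊥ := by
      rw [hbot]
      obtain ⟨U, hU, hxU, -⟩ :=
        exists_isAffineOpen_mem_and_subset (X := V) (x := v) (U := ⊤) (Opens.mem_top v)
      rw [stalkIdeal_eq_map_germ _ ⟨U, hU⟩ hxU, Scheme.IdealSheafData.ideal_bot]
      simp
    obtain ⟨i, hi⟩ := Finset.card_pos.mp (lt_of_lt_of_le (by norm_num) (hadm.two_le v hx))
    have hmem : S.u v i ∈ stalkIdeal C v := by
      rw [hadm.stalkIdeal_eq v hx]; exact Ideal.subset_span ⟨i, hi, rfl⟩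
    rw [hst] at hmem
    exact (isRsopPart_comp_of_rsop (S.spanFinrank_eq v) (S.u v) (S.span_u v) (fun _ : Fin 1 => i)
      (fun _ _ _ => Subsingleton.elim _ _)).ne_zero 0 hmem
  have hbirφ : IsBirational φ := hφ.isBirational' hCne
  haveI : IsDominant φ := hbirφ.isDominant
  have hbirφπ : IsBirational (φ ≫ π) := ComponentGluing.IsBirational.comp hbirφ hbir
  have hbijK : Function.Bijective (RatFn.functionFieldMap (φ ≫ π)) :=
    Picover.TowerTransport.bijective_functionFieldMap_of_isIso (φ ≫ π) hbirφπ.isIso_stalkMap_genericPoint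
  let eK : V₀.functionField ≃+* V'.functionField := RingEquiv.ofBijective _ hbijK
  have heK : ∀ z, eK z = RatFn.functionFieldMap (φ ≫ π) z := fun _ => rfl
  -- the image of the old radicand
  have hmapg : RatFn.functionFieldMap (φ ≫ π) (S.g v) =
      algebraMap (V'.presheaf.stalk x) V'.functionField ((φ.stalkMap x).hom (S.w v * ∏ t, S.u v t ^ S.a v t)) := by
    rw [RatFn.functionFieldMap_comp, RingHom.comp_apply, S.map_g v]
    exact RatFn.functionFieldMap_toFunctionField φ x _
  -- the correcting rational function `κ` (a `p`-th root of `x_i^{Σ a}` when `p ∣ Σ a`, else `1`)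
  let q : ℕ := (∑ l, S.a v (σ l)) / p
  let κ : V₀.functionField := if p ∣ ∑ l, S.a v (σ l) then
    eK.symm (algebraMap (V'.presheaf.stalk x) V'.functionField (Dc.toStalk (φch[Dc] (Dc.x Dc.i))) ^ q) else 1
  have hκ0 : κ ≠ 0 := by
    have hX0 : Dc.toStalk (φch[Dc] (Dc.x Dc.i)) ≠ 0 := by
      rw [← hv0]
      haveI := hregx
      exact (isRsopPart_comp_of_rsop hsf' v' hspan' id Function.injective_id).ne_zero (lab' none)
    simp only [κ]
    split_ifs
    · refine (map_ne_zero_iff eK.symm eK.symm.injective).mpr (pow_ne_zero _ ?_)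
      exact (map_ne_zero_iff _ (IsFractionRing.injective (V'.presheaf.stalk x) V'.functionField)).mpr hX0
    · exact one_ne_zero
  have haOf0 : aOf none = if p ∣ ∑ l, S.a v (σ l) then 0 else ∑ l, S.a v (σ l) := rfl
  have hκp : RatFn.functionFieldMap (φ ≫ π) (κ ^ p) =
      algebraMap (V'.presheaf.stalk x) V'.functionField
        (Dc.toStalk (φch[Dc] (Dc.x Dc.i)) ^ (∑ l, S.a v (σ l) - aOf none)) := by
    rw [haOf0]
    by_cases hdvd : p ∣ ∑ l, S.a v (σ l)
    · have hκdef : κ = eK.symm (algebraMap (V'.presheaf.stalk x) V'.functionField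
          (Dc.toStalk (φch[Dc] (Dc.x Dc.i))) ^ q) := if_pos hdvd
      have hκ : RatFn.functionFieldMap (φ ≫ π) κ =
          algebraMap (V'.presheaf.stalk x) V'.functionField (Dc.toStalk (φch[Dc] (Dc.x Dc.i)) ^ q) := by
        rw [hκdef, ← heK, RingEquiv.apply_symm_apply, map_pow]
      rw [map_pow, hκ, ← map_pow, ← pow_mul, if_pos hdvd, Nat.sub_zero]
      simp only [q]
      rw [Nat.div_mul_cancel hdvd]
    · have hκ : κ = 1 := if_neg hdvd
      rw [hκ, one_pow, map_one, if_neg hdvd, Nat.sub_self, pow_zero, map_one]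
  -- the new generator and radicand
  let y' : L := S.y v / algebraMap V₀.functionField L κ
  let g' : V₀.functionField := S.g v / κ ^ p
  have he_le : aOf none ≤ ∑ l, S.a v (σ l) := by
    rw [haOf0]; split_ifs <;> simp
  have hXne : algebraMap (V'.presheaf.stalk x) V'.functionField
      (Dc.toStalk (φch[Dc] (Dc.x Dc.i)) ^ (∑ l, S.a v (σ l) - aOf none)) ≠ 0 := by
    have hX0 : Dc.toStalk (φch[Dc] (Dc.x Dc.i)) ≠ 0 := by
      rw [← hv0]
      haveI := hregx
      exact (isRsopPart_comp_of_rsop hsf' v' hspan' id Function.injective_id).ne_zero (lab' none)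
    exact (map_ne_zero_iff _ (IsFractionRing.injective (V'.presheaf.stalk x) V'.functionField)).mpr
      (pow_ne_zero _ hX0)
  have hg'map : RatFn.functionFieldMap (φ ≫ π) g' =
      algebraMap (V'.presheaf.stalk x) V'.functionField (w' * ∏ i', v' i' ^ a' i') := by
    have h1 : RatFn.functionFieldMap (φ ≫ π) g' =
        RatFn.functionFieldMap (φ ≫ π) (S.g v) / RatFn.functionFieldMap (φ ≫ π) (κ ^ p) := by
      simp only [g', map_div₀]
    rw [h1, hκp, hmapg, hmap, hlabprod, div_eq_iff hXne, ← map_mul]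
    congr 1
    have hpow : Dc.toStalk (φch[Dc] (Dc.x Dc.i)) ^ (∑ l, S.a v (σ l)) =
        Dc.toStalk (φch[Dc] (Dc.x Dc.i)) ^ aOf none *
          Dc.toStalk (φch[Dc] (Dc.x Dc.i)) ^ (∑ l, S.a v (σ l) - aOf none) := by
      rw [← pow_add, Nat.add_sub_cancel' he_le]
    rw [hpow]
    ring
  -- the new generator is not in `K(V₀)`, with `p`-th power the new radicand
  have hy'not : y' ∉ Set.range (algebraMap V₀.functionField L) := by
    rintro ⟨z, hz⟩
    apply S.y_not_mem v
    refine ⟨z * κ, ?_⟩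
    have hκL : algebraMap V₀.functionField L κ ≠ 0 :=
      (map_ne_zero_iff _ (algebraMap V₀.functionField L).injective).mpr hκ0
    rw [map_mul, hz]
    simp only [y']
    rw [div_mul_cancel₀ _ hκL]
  have hy'pow : algebraMap V₀.functionField L g' = y' ^ p := by
    simp only [g', y', map_div₀, map_pow, div_pow, S.y_pow v]
  -- exponents are `0` or prime to `p`
  have haOfspec : ∀ o, aOf o = 0 ∨ ¬ p ∣ aOf o := by
    rintro (_ | ⟨m⟩ | ⟨g⟩)
    · rw [haOf0]
      by_cases hd : p ∣ ∑ l, S.a v (σ l)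
      · left; rw [if_pos hd]
      · right; rw [if_neg hd]; exact hd
    · exact S.a_spec v (σ' m)
    · exact S.a_spec v (σ g.1)
  have ha'spec : ∀ i', a' i' = 0 ∨ ¬ p ∣ a' i' := by
    intro i'
    by_cases h : ∃ o, lab' o = i'
    · obtain ⟨o, rfl⟩ := h
      rw [ha'lab]; exact haOfspec o
    · left; exact ha'off i' h
  -- the REG clause at the new regular-type points
  have hreg : (∀ i', a' i' = 0) →
      (∀ z : V'.presheaf.stalk x, w' - z ^ p ∉ maximalIdeal (V'.presheaf.stalk x)) ∨
        (∃ z : V'.presheaf.stalk x, w' - z ^ p ∈ maximalIdeal (V'.presheaf.stalk x) ∧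
          w' - z ^ p ∉ maximalIdeal (V'.presheaf.stalk x) ^ 2 ⊔ Ideal.span (v' '' Set.range lab)) := by
    intro hall
    by_cases hex : ∃ z : V'.presheaf.stalk x, w' - z ^ p ∈ maximalIdeal (V'.presheaf.stalk x)
    swap
    · left; push Not at hex; exact hex
    right
    obtain ⟨z, hz⟩ := hex
    refine ⟨z, hz, fun hmem => ?_⟩
    -- no new coordinate is charged: the non-centre exponents vanish, no chart generator passes through `x`
    have hch : ∀ l, S.a v (σ l) ≠ 0 := fun l => by
      have h1 : σ l ∈ ((I v hx : Finset _) : Set _) := hrσ ▸ ⟨l, rfl⟩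
      have h2 := hadm.subset_ch v hx (by exact_mod_cast h1)
      simpa [GameState.ch] using h2
    have hb : ∀ m, S.a v (σ' m) = 0 := fun m => by
      have := hall (lab' (some (Sum.inl m))); rwa [ha'lab] at this
    have he : ∀ j, j ≠ Dc.i → Dc.gen j ∉ Dc.Q := fun j hj hQ => by
      have := hall (lab' (some (Sum.inr ⟨j, hj, hQ⟩))); rw [ha'lab] at this
      exact hch j this
    -- a centre exponent prime to `p` at an index `≠ i`
    have hr2 : 2 ≤ Dc.r := by
      have h := hadm.two_le v hx
      have hcard : (I v hx).card = Dc.r := by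
        have : Finset.univ.image σ = I v hx := by
          apply Finset.coe_injective; rw [Finset.coe_image, Finset.coe_univ, Set.image_univ, hrσ]
        rw [← this, Finset.card_image_of_injective _ hσ, Finset.card_univ, Fintype.card_fin]
      omega
    obtain ⟨j₀, hj₀⟩ : ∃ j₀ : Fin Dc.r, j₀ ≠ Dc.i := by
      by_contra h
      push Not at h
      have : Fintype.card (Fin Dc.r) ≤ 1 := Fintype.card_le_one_iff.mpr fun a b => (h a).trans (h b).symm
      rw [Fintype.card_fin] at this; omega
    have ha : ¬ p ∣ S.a v (σ j₀) := (S.a_spec v (σ j₀)).resolve_left (hch j₀)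
    -- characteristic `p` on the stalk
    haveI : CharP (V'.presheaf.stalk x) p := CharP.of_ringHom_of_ne_zero
      ((V'.presheaf.germ ⊤ x trivial).hom.comp ((φ ≫ π ≫ f₀).appTop.hom.comp
        (Scheme.ΓSpecIso (.of k)).inv.hom)) p hp.ne_zero
    -- the boundary coordinates upstairs are among `x_i` and the old non-centre boundary coordinates
    have hsub : v' '' Set.range lab ⊆ insert (Dc.toStalk (φch[Dc] (Dc.x Dc.i)))
        ((fun m => Dc.toStalk (φch[Dc] (Dc.w m))) '' {m | S.IsLab v (σ' m)}) := by
      rintro _ ⟨_, ⟨D', rfl⟩, rfl⟩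
      by_cases hE : D'.1 = C.comap φ
      · rw [hlabE D' hE, hv0]; exact Set.mem_insert _ _
      · obtain ⟨K, hK⟩ := exists_preimage_divisor D' hE
        rcases hrσσ' (S.lab v K) with ⟨j, hj⟩ | ⟨m, hm⟩
        · obtain ⟨hgood, -⟩ := hlabX D' K j hK hj.symm
          exact absurd hgood.2 (he j hgood.1)
        · rw [hlabW D' K m hK hm.symm, hvw]
          exact Set.mem_insert_of_mem _ ⟨m, ⟨K, hm.symm⟩, rfl⟩
    have hmem' := (sup_le_sup_left (Ideal.span_mono hsub) _) hmem
    exact roundOver_reg hp hxC Dc (S.w v) (S.isUnit_w v) cx cw (fun l => S.a v (σ l)) (fun m => S.a v (σ' m)) hb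
      he hj₀ ha {m | S.IsLab v (σ' m)} z hmem'
  -- the pointwise data
  let P : GameState.PointData p V₀ L V' (φ ≫ π)
      (S.E.map (strictTransformIdeal φ C) ++ [C.comap φ]) x :=
    { d := d', u := v', a := a', w := w', lab := lab, y := y', g := g'
      isRegular := hregx, spanFinrank_eq := hsf', span_u := hspan', a_spec := ha'spec, isUnit_w := hw'
      lab_injective := hlabinj, stalkIdeal_lab := hlabst, y_not_mem := hy'not, y_pow := hy'pow
      map_g := hg'map, reg := hreg }
  have hxE : x ∈ (C.comap φ).support := by
    rw [Scheme.IdealSheafData.support_comap]; exact hxC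
  exact ⟨P, roundOver_measures hp S Dc (I v hx) σ σ' hσ hσ' hrσ hrσσ' hdisj P lab' hlab'inj aOf
    haOf0 (fun _ => rfl) (fun _ => rfl) ha'lab ha'off hxE hlabE hlabW hlabX hsuppW hsuppX⟩

end Main

end Summit.ResolutionOfSingularities.ResolutionOfSingularities.Theorems.RadicialJung.CleanModelsSuffice

end
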